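import Literature.NumberTheory.Sieve.PolymathMkEpsWeights
import Literature.NumberTheory.Sieve.PolymathMkEpsHarmonic
import Mathlib.Tactic.IntervalCases
import HarnessLib

/-!
# Polymath 8b Proposition 6.5, proved: `M_{k,ε} ≤ (k/(k-1)) log(2k-1)` for `k ≥ 2`, `0 ≤ ε < 1`

Topic `Literature/NumberTheory/Sieve`; last support file of the discharge of the named fact
`Literature.Barriers.Parity.Polymath2014_epsFunctional_le` (D. H. J. Polymath, *Variants of the Selberg
sieve, and bounded intervals containing many primes*, Res. Math. Sci. 1:12 (2014) = arXiv:1407.4897,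
Proposition 6.5, pp. 24–25), on the tree's `polymathFunctional` / `IsPolymathTestFunction`
(`PolymathBoundedGaps.lean`): `polymathFunctional_le_log` below is the statement of that fact verbatim.

## The printed proof and its gap

Polymath prove (p. 25) the fibre inequality `(∫ F dtᵢ)² ≤ (log(2k-1)/(k-1)) ∫ (1 - σ + k tᵢ) F² dtᵢ` for outer
points in `(1-ε)·R_{k-1}` (`σ = t₁ + ⋯ + t_k`) and conclude by "integrating … and summing in `i`".  Summing
gives `∑ᵢ J_{i,1-ε}(F) ≤ (log(2k-1)/(k-1)) ∫ F² · ∑ᵢ 1_{Eᵢ} (1 - σ + k tᵢ)` with `Eᵢ = {∑_{j≠i} tⱼ ≤ 1-ε}`, and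
the claim needs the multiplier `∑ᵢ 1_{Eᵢ}(1 - σ + k tᵢ)` to be `≤ k`.  It is `≤ k` where `σ ≤ 1` (all terms
nonnegative), but on `1 < σ ≤ 1+ε` the dropped terms are NEGATIVE and the multiplier reaches `k + (k-1)ε`
at the vertex `(1+ε) eᵢ` (for `k = 2`, `ε = 0.9`, `t = (1.8, 0.05)` it is `2.75`).  So the printed weights
prove only `M_{k,ε} ≤ ((k + (k-1)ε)/(k-1)) log(2k-1)`; the STATEMENT of Proposition 6.5 is nevertheless
true, and this file proves it.

## The completed proof (files `PolymathMkEpsCauchySchwarz`, `…Weights`, `…Harmonic`, this one)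

With the two-zone weights of `PolymathMkEpsWeights.lean` one has, for every `τ ∈ [1-ε, 1]`,
`M_{k,ε} ≤ T_k(ε,τ) = (k/(k-1)) τ log k + (1+ε-τ) + ∑_{j=1}^{k-1} (min(2ε,(1-ε)/j) - (τ-1+ε))₊`
(`polymathFunctional_le_epsT`).
* Regime A (`τ = 1`): `M_{k,ε} ≤ (k/(k-1)) log k + max(log 2, ε)` (`polymathFunctional_le_regimeA`, using
  `MkEps.eps_add_sum_le`: the extra budget `ε + ∑ⱼ (min(2ε,(1-ε)/j) - ε)₊` never exceeds `log 2`).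
* Regime B (`τ = 1-ε`): `M_{k,ε} ≤ 2ε + (1-ε)((k/(k-1)) log k + H_{k-1})` (`polymathFunctional_le_regimeB`; it
  tends to the true limit `2` as `ε → 1`).
* Switch at `ε_A := (k/(k-1)) log((2k-1)/k) ≥ log 2`: below it regime A gives `(k/(k-1)) log(2k-1)` exactly;
  above it regime B does, because `(1-ε_A)((k/(k-1)) log k + H_{k-1} - 2) ≤ (k/(k-1)) log(2k-1) - 2`, which
  after `ε_A ≥ 2k/(3k-1)` (`MkEps.epsA_ge`) is `MkEps.dagger`: `2k + (k-1)H_{k-1} ≤ (2k²/(k-1)) log k`.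
Numerically the worst margins are `≈ 0.19ε + 0.19/k` (small `ε`) and `≈ 0.06` (at `ε ≈ 0.7`, `k = 4, 5`).

## References
* [Polymath8b2014] D. H. J. Polymath, op. cit., Proposition 6.5 (pp. 24–25), Corollary 6.4, Lemma 6.1.
-/

noncomputable section

open MeasureTheory Set Filter Finset
open scoped BigOperators

namespace Literature.NumberTheory.Sieve

namespace MkEps

/-! ### The regime switch: `2(n+1) + n H_n ≤ (2(n+1)²/n) log(n+1)` -/

/-- `j log 2 + (1 - 2ʲ/x) ≤ log x` for every `x > 0` (`1 - 1/y ≤ log y` at `y = x/2ʲ`). [folklore] -/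
theorem log_ge_of_two_pow (j : ℕ) {x : ℝ} (hx : 0 < x) :
    j * Real.log 2 + (1 - 2 ^ j / x) ≤ Real.log x := by
  have h := Real.one_sub_inv_le_log_of_pos (x := x / 2 ^ j) (by positivity)
  rw [inv_div, Real.log_div hx.ne' (by positivity), Real.log_pow] at h
  linarith

/-- **The regime-switch inequality** `(†)`: for `n ≥ 1`, `2(n+1) + n H_n ≤ (2(n+1)²/n) log(n+1)`
(`k = n+1 ≥ 2`, `H_n = ∑_{i<n} 1/(i+1)`).  With `H_n ≤ log(2n+1) ≤ log 2 + log(n+1)` it suffices that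
`log(n+1) (n²+4n+2) ≥ 2n(n+1) + n² log 2`; this is checked from `log k ≥ j log 2 + (1 - 2ʲ/k)` for
`k ≤ 7`, and for `k ≥ 8` from `log k ≥ 3 log 2 + 1 - 8/k` and a polynomial inequality. [folklore] -/
theorem dagger {n : ℕ} (hn : 1 ≤ n) :
    2 * ((n : ℝ) + 1) + n * ∑ i ∈ Finset.range n, 1 / ((i : ℝ) + 1) ≤
      2 * ((n : ℝ) + 1) ^ 2 / n * Real.log ((n : ℝ) + 1) := by
  have hc1 : (0.6931471803 : ℝ) < Real.log 2 := Real.log_two_gt_d9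
  have hc2 : Real.log 2 < (0.6931471808 : ℝ) := Real.log_two_lt_d9
  have hnR : (1 : ℝ) ≤ n := by exact_mod_cast hn
  set c := Real.log 2 with hc
  set L := Real.log ((n : ℝ) + 1) with hL
  -- H_n ≤ log(2n+1) ≤ log 2 + log(n+1)
  have hH : ∑ i ∈ Finset.range n, 1 / ((i : ℝ) + 1) ≤ c + L := by
    refine (harmonic_le_log n).trans ?_
    rw [hc, hL, ← Real.log_mul (by norm_num) (by positivity)]
    exact Real.log_le_log (by positivity) (by linarith)
  -- reduce to a lower bound for L
  suffices hsuff : (2 * n * (n + 1) + n ^ 2 * c) ≤ L * ((n : ℝ) ^ 2 + 4 * n + 2) by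
    have hn0 : (0 : ℝ) < n := by linarith
    rw [div_mul_eq_mul_div, le_div_iff₀ hn0]
    have := mul_le_mul_of_nonneg_left hH (show (0 : ℝ) ≤ n * n by positivity)
    nlinarith
  have hL0 : 0 ≤ L := Real.log_nonneg (by linarith)
  -- case analysis on n = 1, …, 6 and n ≥ 7
  rcases Nat.lt_or_ge n 7 with hlt | hge
  · interval_cases n
    · -- k = 2 : L = log 2
      have e : L = c := by rw [hL, hc]; norm_num
      rw [e]
      norm_num
      nlinarith
    · -- k = 3 : 2 L = log 9 ≥ 3 log 2 + 1/9
      have h9 := log_ge_of_two_pow 3 (x := 9) (by norm_num)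
      have e : Real.log 9 = 2 * L := by
        rw [hL, show ((2 : ℕ) : ℝ) + 1 = 3 by norm_num, show (9 : ℝ) = 3 ^ 2 by norm_num,
          Real.log_pow]; norm_num
      rw [e] at h9
      norm_num at *
      nlinarith
    · -- k = 4 : L = 2 log 2
      have e : L = 2 * c := by
        rw [hL, hc, show ((3 : ℕ) : ℝ) + 1 = 2 ^ 2 by norm_num, Real.log_pow]; norm_num
      norm_num at *
      nlinarith
    · -- k = 5 : L ≥ 2 log 2 + 1/5
      have h5 := log_ge_of_two_pow 2 (x := 5) (by norm_num)
      rw [show (5 : ℝ) = ((4 : ℕ) : ℝ) + 1 by norm_num, ← hL] at h5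
      norm_num at *
      nlinarith
    · -- k = 6 : L = log 2 + log 3, 2 log 3 = log 9 ≥ 3 log 2 + 1/9
      have h9 := log_ge_of_two_pow 3 (x := 9) (by norm_num)
      have e : L = c + Real.log 9 / 2 := by
        rw [hL, hc, show ((5 : ℕ) : ℝ) + 1 = 2 * 3 by norm_num, Real.log_mul (by norm_num) (by norm_num),
          show (9 : ℝ) = 3 ^ 2 by norm_num, Real.log_pow]; norm_num
      norm_num at *
      nlinarith
    · -- k = 7 : L ≥ 2 log 2 + 3/7
      have h7 := log_ge_of_two_pow 2 (x := 7) (by norm_num)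
      rw [show (7 : ℝ) = ((6 : ℕ) : ℝ) + 1 by norm_num, ← hL] at h7
      norm_num at *
      nlinarith
  · -- k ≥ 8 : L ≥ 3 log 2 + 1 - 8/(n+1)
    have h8 := log_ge_of_two_pow 3 (x := (n : ℝ) + 1) (by positivity)
    rw [← hL] at h8
    have hn7 : (7 : ℝ) ≤ n := by exact_mod_cast hge
    have hn1 : (0 : ℝ) < (n : ℝ) + 1 := by positivity
    -- clear the denominator in h8
    have h8' : (3 * c + 1) * ((n : ℝ) + 1) - 8 ≤ L * ((n : ℝ) + 1) := by
      have := mul_le_mul_of_nonneg_right h8 hn1.le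
      have e : ((3 : ℕ) * c + (1 - 2 ^ 3 / ((n : ℝ) + 1))) * ((n : ℝ) + 1) =
          (3 * c + 1) * ((n : ℝ) + 1) - 8 := by field_simp; ring
      push_cast at this e
      linarith [e ▸ this]
    -- it suffices: ((3c+1)(n+1) - 8)(n²+4n+2) ≥ (2n(n+1) + n² c)(n+1)
    have hm : 0 ≤ (n : ℝ) - 7 := by linarith
    nlinarith [mul_nonneg hm hm, mul_nonneg (mul_nonneg hm hm) hm, mul_nonneg hm hL0,
      mul_le_mul_of_nonneg_right h8' (show (0:ℝ) ≤ (n : ℝ) ^ 2 + 4 * n + 2 by positivity)]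

/-! ### `ε_A = (k/(k-1)) log((2k-1)/k)` is at least `2k/(3k-1)` and at least `log 2` -/

/-- `2(n+1)/(3n+2) ≤ ((n+1)/n) (log(2n+1) - log(n+1))` for `n ≥ 1`
(`two_mul_le_log_sub_log` at `x = n/(3n+2)`, where `(1+x)/(1-x) = (2n+1)/(n+1)`). [folklore] -/
theorem epsA_ge {n : ℕ} (hn : 1 ≤ n) :
    2 * ((n : ℝ) + 1) / (3 * n + 2) ≤ ((n : ℝ) + 1) / n * (Real.log (2 * n + 1) - Real.log ((n : ℝ) + 1)) := by
  have hnR : (1 : ℝ) ≤ n := by exact_mod_cast hn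
  have hx := two_mul_le_log_sub_log (x := (n : ℝ) / (3 * n + 2)) (by positivity)
    (by rw [div_lt_one (by positivity)]; linarith)
  have e1 : (1 : ℝ) + n / (3 * n + 2) = (2 * (2 * n + 1)) / (3 * n + 2) := by field_simp; ring
  have e2 : (1 : ℝ) - n / (3 * n + 2) = (2 * (n + 1)) / (3 * n + 2) := by field_simp; ring
  rw [e1, e2, Real.log_div (by positivity) (by positivity), Real.log_div (by positivity) (by positivity),
    Real.log_mul (by norm_num) (by positivity), Real.log_mul (by norm_num) (by positivity)] at hx
  have hn0 : (0 : ℝ) < n := by linarith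
  rw [div_mul_eq_mul_div, le_div_iff₀ hn0, div_mul_eq_mul_div, div_le_iff₀ (by positivity)]
  have e3 : (2 : ℝ) * (n / (3 * n + 2)) * (n * (3 * n + 2)) = 2 * n * n := by field_simp
  nlinarith [mul_le_mul_of_nonneg_right hx (show (0 : ℝ) ≤ n * (3 * n + 2) by positivity)]

/-- `log 2 ≤ ((n+1)/n) (log(2n+1) - log(n+1))` for `n ≥ 1`: `log(2n+1) - log(n+1) ≥ log 2 - 1/(2n+1)` and
`(n+1)/(2n+1) ≤ 2/3 < log 2`. [folklore] -/
theorem log_two_le_epsA {n : ℕ} (hn : 1 ≤ n) :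
    Real.log 2 ≤ ((n : ℝ) + 1) / n * (Real.log (2 * n + 1) - Real.log ((n : ℝ) + 1)) := by
  have hc1 : (0.6931471803 : ℝ) < Real.log 2 := Real.log_two_gt_d9
  have hnR : (1 : ℝ) ≤ n := by exact_mod_cast hn
  have hn0 : (0 : ℝ) < n := by linarith
  -- log(2n+1) - log(2n+2) ≥ 1 - (2n+2)/(2n+1)
  have h := Real.one_sub_inv_le_log_of_pos (x := (2 * n + 1) / (2 * ((n : ℝ) + 1))) (by positivity)
  rw [inv_div, Real.log_div (by positivity) (by positivity), Real.log_mul (by norm_num) (by positivity)]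
    at h
  have e : (1 : ℝ) - 2 * ((n : ℝ) + 1) / (2 * n + 1) = -(1 / (2 * n + 1)) := by field_simp; ring
  rw [e] at h
  rw [div_mul_eq_mul_div, le_div_iff₀ hn0]
  have h2 : ((n : ℝ) + 1) / (2 * n + 1) ≤ 2 / 3 := by
    rw [div_le_div_iff₀ (by positivity) (by norm_num)]; linarith
  have h3 : ((n : ℝ) + 1) * (1 / (2 * n + 1)) = ((n : ℝ) + 1) / (2 * n + 1) := by ring
  nlinarith [mul_le_mul_of_nonneg_left h (show (0 : ℝ) ≤ (n : ℝ) + 1 by positivity)]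


end MkEps

open MkEps

/-! ### The two regimes -/

/-- **Regime A** (`τ = 1`): for `k = n+1 ≥ 2`, `0 ≤ ε < 1` and every test function,
`(∑ᵢ J_{i,1-ε}(F))/I(F) ≤ (k/(k-1)) log k + max(log 2, ε)` — Corollary 6.4's weight on `{σ ≤ 1}` plus the
counting weight on `{σ > 1}`, whose budget `ε + ∑ⱼ(min(2ε,(1-ε)/j) - ε)₊` is `≤ max(log 2, ε)`
(`MkEps.eps_add_sum_le`). [cite: Polymath8b2014, Proposition 6.5 and Corollary 6.4] -/
theorem polymathFunctional_le_regimeA {n : ℕ} (hn : 1 ≤ n) {ε : ℝ} (hε0 : 0 ≤ ε) (hε1 : ε < 1)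
    {F : (Fin (n + 1) → ℝ) → ℝ} (hF : IsPolymathTestFunction (n + 1) ε F) :
    polymathFunctional (n + 1) ε F ≤
      ((n : ℝ) + 1) * Real.log ((n : ℝ) + 1) / n + max (Real.log 2) ε := by
  have hT := polymathFunctional_le_epsT hn hε0 hε1 (τ := 1) (by linarith) le_rfl hF
  have hΛ := eps_add_sum_le hε0 hε1 n
  simp only [mul_one, sub_sub_cancel, add_sub_cancel_left] at hT
  linarith

/-- **Regime B** (`τ = 1 - ε`): for `k = n+1 ≥ 2`, `0 ≤ ε < 1` and every test function,
`(∑ᵢ J_{i,1-ε}(F))/I(F) ≤ 2ε + (1-ε)((k/(k-1)) log k + H_{k-1})` (`H_n = ∑_{i<n} 1/(i+1)`): Corollary 6.4's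
weight on the small simplex `{σ ≤ 1-ε}` and the counting weight beyond, each `j`-th indicator costing at most
`(1-ε)/j`.  As `ε → 1` this tends to `2 = lim M_{k,ε}` (the test functions `1_{tubes}` of §6 give `≥ 1 + ε`).
[cite: Polymath8b2014, Proposition 6.5 and §6 (M_{2,ε} → 2)] -/
theorem polymathFunctional_le_regimeB {n : ℕ} (hn : 1 ≤ n) {ε : ℝ} (hε0 : 0 ≤ ε) (hε1 : ε < 1)
    {F : (Fin (n + 1) → ℝ) → ℝ} (hF : IsPolymathTestFunction (n + 1) ε F) :
    polymathFunctional (n + 1) ε F ≤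
      2 * ε + (1 - ε) * (((n : ℝ) + 1) * Real.log ((n : ℝ) + 1) / n +
        ∑ i ∈ Finset.range n, 1 / ((i : ℝ) + 1)) := by
  have hT := polymathFunctional_le_epsT hn hε0 hε1 (τ := 1 - ε) le_rfl (by linarith) hF
  have hsum : ∑ i ∈ Finset.range n, max 0 (min (2 * ε) ((1 - ε) / ((i : ℝ) + 1)) - (1 - ε - (1 - ε))) ≤
      ∑ i ∈ Finset.range n, (1 - ε) * (1 / ((i : ℝ) + 1)) := by
    refine Finset.sum_le_sum fun i _ => ?_
    rw [sub_self, sub_zero, ← div_eq_mul_one_div]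
    exact max_le (div_nonneg (by linarith) (by positivity)) (min_le_right _ _)
  rw [← Finset.mul_sum] at hsum
  calc polymathFunctional (n + 1) ε F
      ≤ ((n : ℝ) + 1) * (1 - ε) * Real.log ((n : ℝ) + 1) / n + (1 + ε - (1 - ε)) +
          (1 - ε) * ∑ i ∈ Finset.range n, 1 / ((i : ℝ) + 1) := by linarith
    _ = _ := by ring

/-! ### Proposition 6.5 -/

/-- **Polymath 8b, Proposition 6.5 (proved): `M_{k,ε} ≤ (k/(k-1)) log(2k-1)` for `k ≥ 2`, `0 ≤ ε < 1`** — for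
every test function `F` of Theorem 3.12 on `(1+ε)·R_k`, `(∑ᵢ J_{i,1-ε}(F))/I(F) ≤ (k/(k-1)) log(2k-1)`.
This is the statement of the named fact `Literature.Barriers.Parity.Polymath2014_epsFunctional_le` verbatim.
Proof: regime A for `ε ≤ ε_A = (k/(k-1)) log((2k-1)/k)` (`log 2 ≤ ε_A`, `MkEps.log_two_le_epsA`), regime B
above it (`MkEps.epsA_ge`, `MkEps.dagger`); see the module docstring for why the printed argument needed
completing. [cite: Polymath8b2014, Proposition 6.5] -/
theorem polymathFunctional_le_log ⦃k : ℕ⦄ (hk : 2 ≤ k) ⦃ε : ℝ⦄ (hε0 : 0 ≤ ε) (hε1 : ε < 1)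
    ⦃F : (Fin k → ℝ) → ℝ⦄ (hF : IsPolymathTestFunction k ε F) :
    polymathFunctional k ε F ≤ (k : ℝ) / (k - 1) * Real.log (2 * k - 1) := by
  obtain ⟨n, rfl⟩ : ∃ n, k = n + 1 := ⟨k - 1, by omega⟩
  have hn : 1 ≤ n := by omega
  have hnR : (1 : ℝ) ≤ n := by exact_mod_cast hn
  have hn0 : (0 : ℝ) < n := by linarith
  -- the two bounds and the three numerical facts, before introducing abbreviations
  have hA := polymathFunctional_le_regimeA hn hε0 hε1 hF
  have hB := polymathFunctional_le_regimeB hn hε0 hε1 hF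
  have hd := dagger hn
  have hE0 := epsA_ge hn
  have hlog2E := log_two_le_epsA hn
  have hL3 : 1 - ((n : ℝ) + 1)⁻¹ ≤ Real.log ((n : ℝ) + 1) :=
    Real.one_sub_inv_le_log_of_pos (by positivity)
  have hH1 : (1 : ℝ) ≤ ∑ i ∈ Finset.range n, 1 / ((i : ℝ) + 1) := by
    have h := Finset.single_le_sum (f := fun i : ℕ => 1 / ((i : ℝ) + 1)) (fun i _ => by positivity)
      (Finset.mem_range.2 (show 0 < n by omega))
    simpa using h
  -- abbreviations
  set L := Real.log ((n : ℝ) + 1) with hL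
  set L2 := Real.log (2 * (n : ℝ) + 1) with hL2
  set H := ∑ i ∈ Finset.range n, 1 / ((i : ℝ) + 1) with hH
  set P := ((n : ℝ) + 1) * L / n with hP
  set E := ((n : ℝ) + 1) / n * (L2 - L) with hE
  -- the target is `P + E`
  have hPE : P + E = ((n : ℝ) + 1) / n * L2 := by rw [hP, hE]; field_simp; ring
  suffices main : polymathFunctional (n + 1) ε F ≤ P + E by
    refine main.trans (le_of_eq ?_)
    rw [hPE]
    push_cast
    have e1 : (2 : ℝ) * (n + 1) - 1 = 2 * n + 1 := by ring
    have e2 : (n : ℝ) + 1 - 1 = n := by ring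
    rw [e1, e2]
  have hA' : polymathFunctional (n + 1) ε F ≤ P + max (Real.log 2) ε := by rw [hP]; exact hA
  rcases le_or_gt ε E with hεE | hεE
  · -- regime A
    have : max (Real.log 2) ε ≤ E := max_le hlog2E hεE
    linarith
  · -- regime B
    have hB' : polymathFunctional (n + 1) ε F ≤ 2 * ε + (1 - ε) * (P + H) := by rw [hP]; exact hB
    have hP1 : 1 ≤ P := by
      rw [hP, le_div_iff₀ hn0, one_mul]
      have e3 : ((n : ℝ) + 1) * (1 - ((n : ℝ) + 1)⁻¹) = n := by field_simp; ring
      calc (n : ℝ) = ((n : ℝ) + 1) * (1 - ((n : ℝ) + 1)⁻¹) := e3.symm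
        _ ≤ ((n : ℝ) + 1) * L := mul_le_mul_of_nonneg_left hL3 (by positivity)
    -- `H ≤ E (P + H - 1)` from `dagger` and `epsA_ge`
    have hP2 : 2 * ((n : ℝ) + 1) * P = 2 * ((n : ℝ) + 1) ^ 2 / n * L := by
      rw [hP]; field_simp
    have key0 : H * (3 * n + 2) ≤ 2 * ((n : ℝ) + 1) * (P + H - 1) := by nlinarith
    have key : H ≤ E * (P + H - 1) := by
      have h1 : 2 * ((n : ℝ) + 1) / (3 * n + 2) * (P + H - 1) ≤ E * (P + H - 1) :=
        mul_le_mul_of_nonneg_right hE0 (by linarith)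
      refine le_trans ?_ h1
      rw [div_mul_eq_mul_div, le_div_iff₀ (by positivity)]
      linarith
    have h5 : 0 ≤ (ε - E) * (P + H - 2) := mul_nonneg (by linarith) (by linarith)
    -- conclude: 2ε + (1-ε)(P+H) ≤ P + E
    have hfin : 2 * ε + (1 - ε) * (P + H) ≤ P + E := by nlinarith
    linarith

end Literature.NumberTheory.Sieve
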